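import Mathlib.Algebra.BigOperators.Fin
import Mathlib.Algebra.Order.BigOperators.Group.Finset
import Mathlib.Data.Fintype.BigOperators
import Mathlib.Logic.Equiv.Fin.Basic
import Literature.Computability.Complexity.ACRealize
import Literature.Computability.Complexity.PerfectHashFamily
import HarnessLib

/-!
# Small `AC⁰` circuits for polylogarithmic thresholds

Constant-depth unbounded fan-in circuits (in the tree's model: `ACReal f d s` of
`ACRealize.lean` — a gate list over `acBasis = {¬} ∪ {∧ₖ, ∨ₖ}` with `≤ s` gates whose output
wire has `acWeight`-depth `≤ d`) for the threshold functions
`Th_{≥ j}(y) = [j ≤ #{a | y (sel a)}]` over a finite family of input literals, of depth `2r + 2`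
and size `(N + 1) · ((Θ+1)^b (b+1) + 1)^r + 1` whenever `j ≤ Θ` and `2Θ² < b^r`
(`acReal_threshold`). With `Θ`, `b` polylogarithmic in the ambient input length and `r` a
constant this is the classical fact that polylogarithmic thresholds are in `AC⁰` with circuits
of size `N^{1+o(1)}` (Ajtai–Ben-Or 1984; Fagin–Klawe–Pippenger–Stockmeyer 1985;
Ragde–Wigderson 1991); it is the counting primitive of the `AC⁰` kernelization behind
hardness magnification for `k`-Vertex-Cover / `(n-k)`-Clique (Oliveira–Santhanam 2018;
Chen–Hirahara–Oliveira–Pich–Rajgopal–Santhanam 2020, Prop. 50).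

Construction (all proved):
* `Nat.le_sum_iff_exists_distrib` — `j ≤ ∑ᵢ cᵢ ↔ ∃ τ ≤ c, ∑ᵢ τᵢ = j` (distributing tokens);
* `acReal_cappedCount_tree` — a complete `b`-ary tree of height `h` whose leaves are realized
  Boolean functions `φ a` (`a : Fin h → Fin b`): the bit `[j ≤ #{a | φ a x}]`, for `j ≤ Θ`, is
  realized as a FORMULA of depth `d₀ + 2h` — each node is an `∨` over the `≤ (Θ+1)^b` token
  distributions `τ` of an `∧` of its children's bits `[τᵢ ≤ count of child i]`;
* `acReal_threshold` — hash the family into `b^r` buckets by each member of a perfect hash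
  family (`exists_perfectHashFamily`: `N + 1` maps, every `≤ Θ`-subset injective under one of
  them), take the `∨` of each bucket (depth `1`, one gate), count non-empty buckets with the
  tree, and `∨` over the family: `#{a | y (sel a)} ≥ j` iff some member sees `≥ j` non-empty
  buckets.

## References

* M. Ajtai, M. Ben-Or, *A theorem on probabilistic constant depth computations*, STOC 1984.
* R. Fagin, M. Klawe, N. Pippenger, L. Stockmeyer, *Bounded-depth, polynomial-size circuits for
  symmetric functions*, Theoret. Comput. Sci. 36 (1985).
* P. Ragde, A. Wigderson, *Linear-size constant-depth polylog-threshold circuits*,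
  Inform. Process. Lett. 39 (1991).
* I. C. Oliveira, R. Santhanam, *Hardness magnification for natural problems*, FOCS 2018, §3.
-/

namespace Literature.Computability.Complexity

open Finset

/-! ### Distributing tokens -/

/-- `j ≤ ∑ᵢ cᵢ` iff `j` tokens can be distributed as `τ ≤ c` with `∑ᵢ τᵢ = j`. [folklore] -/
theorem _root_.Nat.le_sum_iff_exists_distrib :
    ∀ (b : ℕ) (c : Fin b → ℕ) (j : ℕ),
      j ≤ ∑ i, c i ↔ ∃ τ : Fin b → ℕ, (∀ i, τ i ≤ c i) ∧ ∑ i, τ i = j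
  | 0, c, j => by
    simp only [univ_eq_empty, sum_empty, nonpos_iff_eq_zero, IsEmpty.forall_iff, true_and]
    exact ⟨fun h => ⟨fun i => i.elim0, h.symm⟩, fun ⟨_, h⟩ => h.symm⟩
  | b + 1, c, j => by
    rw [Fin.sum_univ_succ]
    constructor
    · intro hj
      -- give `min j (c 0)` tokens to child `0`, distribute the rest recursively
      have hrest : j - min j (c 0) ≤ ∑ i : Fin b, c i.succ := by omega
      obtain ⟨τ', hτ'le, hτ'sum⟩ :=
        (Nat.le_sum_iff_exists_distrib b (fun i => c i.succ) _).1 hrest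
      refine ⟨Fin.cons (min j (c 0)) τ', fun i => ?_, ?_⟩
      · refine Fin.cases ?_ (fun i => ?_) i
        · simp
        · simpa using hτ'le i
      · rw [Fin.sum_univ_succ]
        simp only [Fin.cons_zero, Fin.cons_succ, hτ'sum]
        omega
    · rintro ⟨τ, hτle, rfl⟩
      rw [Fin.sum_univ_succ]
      exact Nat.add_le_add (hτle 0) (sum_le_sum fun i _ => hτle i.succ)

/-! ### The capped-count tree -/

/-- Counting over `Fin (h+1) → Fin b` fibrewise along the first coordinate. [folklore] -/
theorem card_filter_finSucc_eq_sum {b h : ℕ} (p : (Fin (h + 1) → Fin b) → Prop) [DecidablePred p] :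
    (univ.filter p).card =
      ∑ i : Fin b, (univ.filter fun a : Fin h → Fin b => p (Fin.cons i a)).card := by
  simp only [card_filter]
  rw [← Fintype.sum_prod_type']
  refine (Fintype.sum_equiv (Fin.consEquiv fun _ => Fin b).symm _ _ fun a => ?_)
  simp only [Fin.consEquiv]
  congr 2
  exact (Fin.cons_self_tail a).symm

/-- **The capped-count tree.** Let the leaves `a : Fin h → Fin b` of the complete `b`-ary tree
of height `h` carry Boolean functions `φ a`, each realized over `acBasis` at depth `d₀ ≥ 1`
with `s₀ ≥ 1` gates. Then for every `j ≤ Θ` the bit `[j ≤ #{a | φ a x}]` is realized at depth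
`d₀ + 2h` with at most `s₀ · ((Θ+1)^b (b+1) + 1)^h` gates: a node is the `∨`, over the token
distributions `τ : Fin b → {0,…,Θ}` with `∑ τᵢ = j`, of the `∧` of its children's bits
`[τᵢ ≤ count below child i]` (formula-style recursion; Fagin–Klawe–Pippenger–Stockmeyer 1985,
divide and conquer for small thresholds). [folklore] -/
theorem acReal_cappedCount_tree {ι : Type*} {b Θ d₀ s₀ : ℕ} (hd₀ : 1 ≤ d₀) (hs₀ : 1 ≤ s₀) :
    ∀ (h : ℕ) (φ : (Fin h → Fin b) → (ι → Bool) → Bool), (∀ a, ACReal (φ a) d₀ s₀) →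
      ∀ j, j ≤ Θ →
        ACReal (fun x => decide (j ≤ (univ.filter fun a => φ a x = true).card)) (d₀ + 2 * h)
          (s₀ * ((Θ + 1) ^ b * (b + 1) + 1) ^ h) := by
  intro h
  induction h with
  | zero =>
    intro φ hφ j _
    -- a single leaf `default`: the count is `[φ default x]`
    have hcount : ∀ x : ι → Bool, (univ.filter fun a : Fin 0 → Fin b => φ a x = true).card =
        if φ default x = true then 1 else 0 := by
      intro x
      rw [univ_unique, filter_singleton]
      split <;> simp
    rcases Nat.lt_or_ge j 2 with hj2 | hj2
    · interval_cases j
      · refine ((acReal_const (ι := ι) true).mono hd₀ (by simpa using hs₀)).congr fun x => ?_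
        simp
      · refine ((hφ default).mono (by simp) (by simp)).congr fun x => ?_
        rw [hcount x]
        cases φ default x <;> simp
    · refine ((acReal_const (ι := ι) false).mono hd₀ (by simpa using hs₀)).congr fun x => ?_
      rw [hcount x]
      symm
      simp only [decide_eq_false_iff_not, not_le]
      split <;> omega
  | succ h ih =>
    intro φ hφ j hj
    set A := (Θ + 1) ^ b * (b + 1) + 1 with hA
    set B := s₀ * A ^ h with hB
    -- children
    have hch : ∀ (i : Fin b) (j' : ℕ), j' ≤ Θ →
        ACReal (fun x => decide (j' ≤ (univ.filter fun a : Fin h → Fin b =>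
          φ (Fin.cons i a) x = true).card)) (d₀ + 2 * h) B :=
      fun i j' hj' => ih (fun a => φ (Fin.cons i a)) (fun a => hφ _) j' hj'
    -- token distributions
    let T := {τ : Fin b → Fin (Θ + 1) // ∑ i, (τ i : ℕ) = j}
    have hT : Fintype.card T ≤ (Θ + 1) ^ b := by
      refine (Fintype.card_subtype_le _).trans ?_
      simp
    -- for each `τ`: the `∧` of the children's bits
    have hand : ∀ τ : T, ACReal (fun x => decide (∀ i : Fin b, decide ((τ.1 i : ℕ) ≤
        (univ.filter fun a : Fin h → Fin b => φ (Fin.cons i a) x = true).card) = true))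
        (d₀ + 2 * h + 1) (b * B + 1) := by
      intro τ
      have := acReal_forall (f := fun i x => decide ((τ.1 i : ℕ) ≤
        (univ.filter fun a : Fin h → Fin b => φ (Fin.cons i a) x = true).card))
        (s := fun _ => B) fun i => hch i _ (by have := (τ.1 i).isLt; omega)
      simpa using this
    -- the `∨` over `τ`
    have hor := acReal_exists_fintype hand
    refine (hor.mono (by omega) ?_).congr fun x => ?_
    · -- size
      have hB1 : 1 ≤ B := by
        rw [hB]; exact Nat.mul_le_mul hs₀ (Nat.one_le_pow _ _ (by omega)) |>.trans' (by simp)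
      calc Fintype.card T * (b * B + 1) + 1 ≤ (Θ + 1) ^ b * (b * B + 1) + 1 :=
            Nat.add_le_add_right (Nat.mul_le_mul_right _ hT) 1
        _ ≤ (Θ + 1) ^ b * (b * B + B) + B :=
            Nat.add_le_add (Nat.mul_le_mul_left _ (Nat.add_le_add_left hB1 _)) hB1
        _ = B * A := by rw [hA]; ring
        _ = s₀ * A ^ (h + 1) := by rw [hB, pow_succ]; ring
    · -- semantics
      simp only [decide_eq_true_eq, decide_eq_decide]
      rw [card_filter_finSucc_eq_sum (fun a => φ a x = true), Nat.le_sum_iff_exists_distrib]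
      constructor
      · rintro ⟨τ, hτ⟩
        exact ⟨fun i => (τ.1 i : ℕ), hτ, τ.2⟩
      · rintro ⟨τ, hτle, hτsum⟩
        have hτΘ : ∀ i, τ i < Θ + 1 := fun i => by
          have : τ i ≤ ∑ i, τ i := single_le_sum (fun _ _ => Nat.zero_le _) (mem_univ i)
          omega
        exact ⟨⟨fun i => ⟨τ i, hτΘ i⟩, by simpa using hτsum⟩, fun i => by simpa using hτle i⟩

/-! ### Polylogarithmic thresholds by perfect hashing -/

/-- The `∨` of a finite family of input literals is realized at depth `1` with one gate.
[folklore] -/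
theorem acReal_exists_input {κ : Type*} {β : Type*} [Fintype β] (sel : β → κ) :
    ACReal (fun y : κ → Bool => decide (∃ c : β, y (sel c) = true)) 1 1 := by
  simpa using acReal_exists_fintype (f := fun (c : β) (y : κ → Bool) => y (sel c))
    (d := 0) (s := 0) fun c => acReal_input (sel c)

/-- **Polylogarithmic thresholds in small constant depth.** For a finite family of input
positions `sel : α → κ` (`N = |α|`), a cap `Θ`, and tree parameters `b`, `r` with `2Θ² < b^r`,
every threshold bit `[j ≤ #{a | y (sel a)}]` with `j ≤ Θ` is realized over `acBasis` at depth
`2r + 2` with at most `(N + 1) · ((Θ+1)^b (b+1) + 1)^r + 1` gates: hash `α` into the `b^r`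
leaves of the capped-count tree by each member of a perfect hash family of `N + 1` maps
(`exists_perfectHashFamily`), put at each leaf the `∨` of its bucket, count the non-empty
buckets up to `j` (`acReal_cappedCount_tree`), and take the `∨` over the family — if `≥ j`
positions are on, a `j`-subset of them is hashed injectively by some member, giving `≥ j`
non-empty buckets; conversely non-empty buckets are never more than on-positions. For `Θ`, `b`
polylogarithmic and `r` constant the size is `N^{1+o(1)}` (Ragde–Wigderson 1991;
Fagin–Klawe–Pippenger–Stockmeyer 1985). [folklore] -/
theorem acReal_threshold {κ : Type*} {α : Type*} [Fintype α] [DecidableEq α] (sel : α → κ)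
    {Θ b r : ℕ} (hbr : 2 * Θ ^ 2 < b ^ r) (j : ℕ) (hj : j ≤ Θ) :
    ACReal (fun y : κ → Bool => decide (j ≤ (univ.filter fun a => y (sel a) = true).card))
      (2 * r + 2) ((Fintype.card α + 1) * ((Θ + 1) ^ b * (b + 1) + 1) ^ r + 1) := by
  classical
  -- buckets = leaves of the tree
  set β := Fin r → Fin b
  have hβ : Fintype.card β = b ^ r := by simp [β]
  -- a perfect hash family into the leaves
  obtain ⟨hs₀, hhs₀⟩ := exists_perfectHashFamily α (Θ := Θ) (R := b ^ r) hbr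
  let e : β ≃ Fin (b ^ r) := Fintype.equivOfCardEq (by rw [hβ, Fintype.card_fin])
  let hs : Fin (Fintype.card α + 1) → α → β := fun l a => e.symm (hs₀ l a)
  have hhs : ∀ S : Finset α, S.card ≤ Θ → ∃ l, Set.InjOn (hs l) ↑S := by
    intro S hS
    obtain ⟨l, hl⟩ := hhs₀ S hS
    exact ⟨l, fun a ha a' ha' h => hl ha ha' (e.symm.injective h)⟩
  -- leaves: the `∨` of each bucket
  let φ : Fin (Fintype.card α + 1) → β → (κ → Bool) → Bool := fun l c y =>
    decide (∃ a : {a // hs l a = c}, y (sel a.1) = true)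
  have hφ : ∀ l c, ACReal (φ l c) 1 1 := fun l c =>
    acReal_exists_input fun a : {a // hs l a = c} => sel a.1
  -- the trees, one per hash function
  have htree : ∀ l, ACReal (fun y => decide (j ≤ (univ.filter fun c => φ l c y = true).card))
      (1 + 2 * r) (1 * ((Θ + 1) ^ b * (b + 1) + 1) ^ r) :=
    fun l => acReal_cappedCount_tree le_rfl le_rfl r (φ l) (hφ l) j hj
  have hor := acReal_exists htree
  refine (hor.mono (by omega) (by simp)).congr fun y => ?_
  -- semantics: some hash function sees `≥ j` non-empty buckets iff `≥ j` positions are on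
  set S := univ.filter fun a => y (sel a) = true with hS
  have hbuckets : ∀ l, (univ.filter fun c => φ l c y = true) = S.image (hs l) := by
    intro l
    ext c
    simp only [φ, hS, mem_filter, mem_univ, true_and, decide_eq_true_eq, mem_image]
    exact ⟨fun ⟨a, ha⟩ => ⟨a.1, ha, a.2⟩, fun ⟨a, ha, hac⟩ => ⟨⟨a, hac⟩, ha⟩⟩
  simp only [decide_eq_true_eq, decide_eq_decide, hbuckets]
  constructor
  · rintro ⟨l, hl⟩
    exact hl.trans card_image_le
  · intro hjS
    obtain ⟨S', hS'S, hS'card⟩ := exists_subset_card_eq hjS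
    obtain ⟨l, hl⟩ := hhs S' (hS'card.le.trans hj)
    refine ⟨l, ?_⟩
    calc j = (S'.image (hs l)).card := by rw [card_image_of_injOn hl, hS'card]
      _ ≤ (S.image (hs l)).card := card_le_card (image_subset_image hS'S)

end Literature.Computability.Complexity
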